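import Summits.ResolutionOfSingularities.ResolutionOfSingularities.Theorems.ExitCutKernels
import Literature.AlgebraicGeometry.Resolution.SigmaMaxEliminationInDim
import HarnessLib

/-!
# ExitCutKernels2 — decomp-res node «ExitCut» (lens-2 g27, critic row 212 CLEARED · MAP +1 ONCE (port layer 1)),
tree file 2/3 of the node

Content VERBATIM from the decomp-res lens-2 g27 node `HOME/decomp-res-lens-2/g27/ExitCut.lean` (pin a67800dc; no
carry, imports the landed g24 node + ForcedTowerClasses + Literature; ns `…Theses.ExitCut` ↦ `…Theorems.ExitCut`);
HOME = run/shared/lean/pub/decomp-res; critic CRITIC-LEDGER row 212 CLEARED · MAP +1 ONCE (port layer 1):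
`oneShotPort_holds : ∀ n, OneShotPort n` in kernel; landing orders LANDING NOTE :1437 + rider 11:18:17Z — provenance
and critic text in full in `ExitCutKernels`, the lens header verbatim in `ExitCutKernels2`.  `--kind proof
--supports stmt-ResolutionOfSingularities-29273`.

The lens header, verbatim (carried in this file of the node):

> # ExitCut — decomp-res lens-2 («structural dichotomy (special vs generic)») g27:
> # THE ONE-CENTRE EXIT MECHANISM IN KERNEL — `FaceFormCutClasses.OneShotPort n` PROVED FOR EVERY `n`
>
> COLUMN TARGET (BY NAME): `MaxContactCut.RungOne : E 2 → E 1` (tree item stmt-ResolutionOfSingularities-29273; lens-2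
> aside 33866 `MaxContactCut.LeafSpecialRung`).  Host: the LANDED g9 classes `Theorems.FaceFormCutClasses` (`OneShotPort`,
> `OrderOneContact`, `IsExitPt`, `ExitsAt`, consumers `genericRung_of_engine` / `genRungAt_of_engine` / `genRungAt_one`)
> and the LANDED g24/g25 wiring `Theorems.MaxContactCutCuspCut` (`CuspX.closes`, `CuspX.cuspGenericRung_of_ports`,
> `CuspX.closes_of_engines`) — imported, nothing carried.  Critic window row 208 / MAP door «discharge of
> `ComponentPackagePort`» (rows 200/208), PRE-PRICED (STATUS `PRICING decomp-res-crit-1 g8 2026-08-31T10:53:29Z`, INBOX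
> :1413): «(K1) `oneShotPort_holds : ∀ n, OneShotPort n` hyp-free in kernel = MAP +1 ONCE (port layer 1); conditions
> (e1)–(e8)».
>
> ## WHAT IS PROVED (all sorry-free, axioms ⊆ {propext, Classical.choice, Quot.sound}, landed imports only)
>
> * §K.1 `isContactPt_iff_not_le_sq`, `isContactPt_iff_exists_stalk` — MAXIMAL CONTACT READ ON THE STALK:
>   `IsContactPt g 𝓘 n y ⟺ ∃ z ∈ Diff^{≤ n-1}(𝓘)_y, z ∈ 𝔪_y ∖ 𝔪_y²` (order-free; the section is recovered from the stalk
>   element through `exists_section_germ_mem_not_mem_sq`, the stalk being the localisation of an affine neighbourhood);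
>   `isContactPt_one` — order `1` is maximal contact.
> * §K.2 `isContactPt_controlledTransform_of_not_mem` — maximal contact is TRANSPORTED OFF THE CENTRE of any blow-up
>   (`π.stalkMap` is a `k`-algebra isomorphism there; `stalkIdeal_diffIdealSheaf` + `diffIdeal_map_algEquiv` +
>   `IsBlowup.stalkIdeal_controlledTransform_of_not_mem` + `stalkIdeal_comap_eq_map_stalkMap`).
> * §K.3 the ONE-SHOT CENTRE: `exitLocus` (top points not of class ≥ 2) is FINITE (`exitLocus_finite`: Top-isolation
>   makes it a discrete noetherian subspace) and closed; `exitCentre` = the reduced subscheme on it; its stalks are the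
>   maximal ideals (`stalkIdeal_exitCentre`, via `stalkIdeal_vanishingIdeal_congr/_singleton`), so `exitCentre.subscheme`
>   is REGULAR (`isRegular_exitCentre_subscheme`, via `Scheme.isRegular_subscheme_of_forall`) and it lies in `Supp(𝓘, n)`.
> * §K.4 GENERIC ONE-STEP LEMMAS (any centre): `classGE_controlledTransform_of_not_mem` (class ≥ j transported off
>   the centre: contact by §K.2, `τ` by `IsBlowup.stalkTau_controlledTransform_of_not_mem`), `weakResolution_cons`
>   (concatenation; `WeakResolution` ignores the boundary, `ForcedTowerClasses.weakResolution_congr`).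
> * §K.5 THE KERNEL: `classGE_controlledTransform_exitCentre` (over the centre `ExitsAt` gives `τ ≥ 3`),
>   **`oneShotPort_holds (n) : OneShotPort n` for EVERY `n`** (frame persistence: `IsBlowup.isProper`,
>   `IsBlowup.isRegular_of_isRegular_subscheme`, `IsBlowup.topologicalKrullDim_le_of_isLocallyNoetherian`,
>   `IsBlowup.idealOrder_controlledTransform_le_of_forall/_of_not_mem`; then `SeqDimFour 2 n` and `weakResolution_cons`),
>   `oneShotPort_holds'` (the `∀ n ≥ 2` binder shape), **`orderOneContact_holds : OrderOneContact`** (0-weight hygiene).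
> * §K.6 BY-NAME COROLLARIES through the landed consumers: `genericRung_of_faceFormExit : FaceFormExit → GenericRung`
>   (`genericRung_of_engine` with BOTH port binders discharged), `genRungAt_of_faceFormExit`, `genRungAt_one_holds`,
>   `lGenRungAt_one_holds`, `dGenRungAt_one_holds`, `pGenRungAt_one_holds`; `cuspGenericRung_of_ports` and
>   `closes_of_engines` = the landed `CuspX` wirings with the binder `h1 : OrderOneContact` REMOVED (0-weight re-wiring);
>   `closes = CuspX.closes : CuspGenericRung → CuspSpecialRung → MaxContactCut.RungOne` BY NAME.
> * §K.7 THE PORT RESIDUAL TYPED (0-weight, NOT claimed decided): `MultiUnitPackageTransport n` (= `ComponentPackagePort n`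
>   minus its final `SeqDimFour 2 n` step: transport of the units' packages through one another's blow-ups) with the kernel
>   implication `componentPackagePort_of_multiUnitPackageTransport` (`weakAdmissible_append_iff`, `weakResolution_append`,
>   `CentreSeq.isProper_comp`, `CentreSeq.topologicalKrullDim_top_le`) and `multiUnit_conclusion_of_exitPts` (the
>   one-centre layer is the point-unit case).
>
> ## VERDICT TAGS
>
> `OneShotPort n` (all `n`) — **PROVED (kernel)**, was COSTUME(M)/STATEMENT since g9 · `OrderOneContact` — **PROVED (kernel)**
> · `FaceFormCutClasses.GenericRung ⟸ FaceFormExit` ALONE — PROVED (corollary) · `ComponentPackagePort n` — UNDECIDED,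
> residual letter FIXED as `MultiUnitPackageTransport n` (kernel `→`) · located residuals UNCHANGED and untouched:
> `NonFaceCuspExit` [UNDECIDED · HYP; g26, landing queued] ≡ the wild rest of `CuspExit` [UNDECIDED · HYP in the tree],
> `CuspX.CuspSpecialRung` [UNDECIDED] · NO new cell, NO re-location.
>
> WHY EACH REMAINING PIECE IS STRICTLY WEAKER THAN THE TARGET: `closes` needs BOTH `CuspGenericRung` (decided modulo the
> listed engines + `ComponentPackagePort`) and `CuspSpecialRung`; neither implies `RungOne` alone (Probe P5/P6), and
> `MultiUnitPackageTransport n` concludes class ≥ 2 after a sequence, not a resolution (Probe P2/P3).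
> WHY NOVEL (relative to g9–g26): every located cut of the column since g9 carried the port as a hypothesis binder
> (`hP`/`h1` in `genericRung_of_engine`, `cuspGenericRung_of_ports`, …); this node turns the one-centre exit mechanism into a
> theorem at scheme level (finite Top-isolated exit set ↦ ONE regular weakly-admissible centre ↦ frame persistence on
> `Bl_C Y` ↦ class ≥ 2 at every top point of the controlled transform ↦ `SeqDimFour 2 n` ↦ concatenation) and removes the
> (M)/(S) binders from the landed consumers.
>
> FRAME FACTS NEEDED BEYOND THE TREE (e7): none typed, none assumed — the `k`-structure of `Bl_C Y` is `blowup.π C ≫ g`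
> (separated / locally of finite type / quasi-compact by instance composition from `IsBlowup.isProper`), noetherianity of
> `Y` from `LocallyOfFiniteType.isLocallyNoetherian` + `QuasiCompact.compactSpace_of_compactSpace`, the compatibility of the
> two `k`-structures on the stalks from `Scheme.Hom.germ_stalkMap_apply` + `Scheme.Hom.comp_appTop`; no new Literature fact,
> no hypothesis binder.  KIT: none (desk only).

## This file

§K.5 `section Kernel` — THE KERNEL: `classGE_controlledTransform_exitCentre`, **`oneShotPort_holds (n) : OneShotPort
n`** (every `n`, hypothesis-free), `oneShotPort_holds'`, **`orderOneContact_holds : OrderOneContact`**; §K.7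
`section Residual` — THE PORT RESIDUAL, typed (0-weight): `weakAdmissible_append_iff`, `weakResolution_append`, the
letter **`MultiUnitPackageTransport n`** [UNDECIDED · NOT claimed; cone-free home = this file],
`componentPackagePort_of_multiUnitPackageTransport`, `multiUnit_conclusion_of_exitPts`.

[WRITER NOTE (decomp-res writer g13): file split only (tree files ≤ 400 lines); sections, section `variable`s /
`open`s and every declaration exactly as in the lens (namespace renamed Theses ↦ Theorems, the HOME-only
dupNamespace-linter line dropped; `noncomputable section` and the five file-level `open` lines replayed in every file).]

(Sources: Hironaka1964 Ch. III §§1–3, §7; Giraud1975; CossartJannsenSaito2020 Ch. 2, Ch. 8–9; EGAIV4 §16–§17;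
Matsumura1987 §28–§30; CossartPiltant2008 Prop. 4.2; BierstoneMilman1997 §3; Cutkosky2004 Ch. 6–7; Kollar2007 §3;
StacksProject 01WV / 0806 / 080A.)
-/

noncomputable section

open CategoryTheory AlgebraicGeometry IsLocalRing TopologicalSpace Topology
open Literature.AlgebraicGeometry.Resolution
open Summit.ResolutionOfSingularities.ResolutionOfSingularities.Theorems
open Summit.ResolutionOfSingularities.ResolutionOfSingularities.Theorems.WeakOrderReduction
open Summit.ResolutionOfSingularities.ResolutionOfSingularities.Theorems.FaceFormCutClasses

namespace Summit.ResolutionOfSingularities.ResolutionOfSingularities.Theorems.ExitCut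

section Kernel

variable {k : Type} [Field k] {Y : Scheme.{0}} {g : Y ⟶ Spec (.of k)} {hY : Scheme.IsRegular Y}
  {I : Y.IdealSheafData} {n : ℕ}

/-! ## §K.5  The kernel: `OneShotPort n` for every `n` -/

/-- **Class `≥ 2` OVER the one-shot centre** (any blow-up `π` of `Y` in it): at a top point `x'` of the
controlled transform lying over an exit point, the exit property `ExitsAt` (fed with the centre's stalk
`= 𝔪_{π x'}`, `stalkIdeal_exitCentre`) gives `τ ≥ 3`. [folklore] -/
theorem classGE_controlledTransform_exitCentre [IsNoetherian Y] [LocallyOfFiniteType g]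
    (hcls : ∀ y : Y, idealOrder I y = n → ClassGE g hY I n 2 y ∨ IsExitPt I n y)
    {Y' : Scheme.{0}} {π : Y' ⟶ Y} (hπ : IsBlowup π (exitCentre hcls)) [IsLocallyNoetherian Y']
    (hY' : Scheme.IsRegular Y') {x : Y'} (hxS : π x ∈ exitLocus g hY I n)
    (hx : idealOrder (controlledTransform π (exitCentre hcls) I n) x = n) :
    ClassGE (π ≫ g) hY' (controlledTransform π (exitCentre hcls) I n) n 2 x := by
  haveI : IsLocallyNoetherian Y := LocallyOfFiniteType.isLocallyNoetherian g
  obtain ⟨-, -, d, c, hc, -, hex⟩ := isExitPt_of_mem_exitLocus hcls hxS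
  haveI : IsRegularLocalRing (Y'.presheaf.stalk x) := hY' x
  have h3 := hex Y' π ⟨exitLocus g hY I n, isClosed_exitLocus hcls⟩ hπ inferInstance inferInstance
    (hc.trans (stalkIdeal_exitCentre hcls hxS).symm) x rfl (hY' x) hx
  refine Or.inr (Or.inr ⟨by norm_num, ?_⟩)
  change 2 ≤ stalkTau (controlledTransform π (exitCentre hcls) I n) x n
  exact le_trans (by norm_num) h3.2

/-- **KERNEL (MAP door «discharge of the port», one-centre layer).** The one-shot port
`FaceFormCutClasses.OneShotPort n` holds hypothesis-free for EVERY `n`: blow up the (finite, reduced) exit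
locus ONCE; the frame of `SeqDimFour` survives on `Bl_C Y` (`IsBlowup.isProper`,
`IsBlowup.isRegular_of_isRegular_subscheme`, `IsBlowup.topologicalKrullDim_le_of_isLocallyNoetherian`,
`IsBlowup.idealOrder_controlledTransform_le_of_forall`); every top point of the controlled transform is of class
`≥ 2` (over `C`: `classGE_controlledTransform_exitCentre`; off `C`:
`classGE_controlledTransform_of_not_mem` with `IsBlowup.idealOrder_controlledTransform_of_not_mem`);
`SeqDimFour 2 n` resolves the transform and `weakResolution_cons` concatenates. [folklore] -/
theorem oneShotPort_holds (n : ℕ) : OneShotPort n := by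
  intro h2 p hp k _ _ Y g hg1 hg2 hg3 hY h4 I hord hcls
  haveI := hg1; haveI := hg2; haveI := hg3
  haveI : IsLocallyNoetherian Y := LocallyOfFiniteType.isLocallyNoetherian g
  haveI : CompactSpace Y := QuasiCompact.compactSpace_of_compactSpace g
  haveI : IsNoetherian Y := {}
  -- the centre
  set C : Y.IdealSheafData := exitCentre hcls with hC
  have hCsupp : (C.support : Set Y) = exitLocus g hY I n := coe_support_exitCentre hcls
  have hCreg : Scheme.IsRegular C.subscheme := isRegular_exitCentre_subscheme hcls
  -- the blow-up and its frame
  have hπ : IsBlowup (blowup.π C) C := blowup.isBlowup C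
  haveI : IsProper (blowup.π C) := hπ.isProper
  haveI : IsLocallyNoetherian (blowup C) := LocallyOfFiniteType.isLocallyNoetherian (blowup.π C)
  have hY₁ : Scheme.IsRegular (blowup C) := IsBlowup.isRegular_of_isRegular_subscheme hY hCreg hπ
  have hdim : topologicalKrullDim (blowup C) ≤ 4 := by
    have := hπ.topologicalKrullDim_le_of_isLocallyNoetherian (n := 4) (by exact_mod_cast h4)
    exact_mod_cast this
  have hord₁ : ∀ x : blowup C, idealOrder (controlledTransform (blowup.π C) C I n) x ≤ n := fun x =>
    hπ.idealOrder_controlledTransform_le_of_forall hY hCreg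
      (fun y hy => by exact (show y ∈ exitLocus g hY I n from hy).1) hord x
  have hcls₁ : ∀ x : blowup C, idealOrder (controlledTransform (blowup.π C) C I n) x = n →
      ClassGE (blowup.π C ≫ g) hY₁ (controlledTransform (blowup.π C) C I n) n 2 x := by
    intro x hx
    by_cases hxS : (blowup.π C) x ∈ exitLocus g hY I n
    · exact classGE_controlledTransform_exitCentre hcls hπ hY₁ hxS hx
    · have hxC : (blowup.π C) x ∉ (C.support : Set Y) := by rw [hCsupp]; exact hxS
      have hordx : idealOrder I ((blowup.π C) x) = n := by
        rw [← hπ.idealOrder_controlledTransform_of_not_mem I n hxC]; exact hx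
      have hcl0 : ClassGE g hY I n 2 ((blowup.π C) x) := by
        by_contra hno; exact hxS ⟨hordx, hno⟩
      exact classGE_controlledTransform_of_not_mem g hπ hY hY₁ I n n 2 hxC hcl0
  -- the inductive engine on the blow-up, then concatenate
  obtain ⟨t₁, ht₁⟩ := h2 p hp k (blowup C) (blowup.π C ≫ g) inferInstance inferInstance
    inferInstance hY₁ hdim _ hord₁ hcls₁
  refine ⟨CentreSeq.cons C t₁, weakResolution_cons C I n ?_ hCreg t₁ ht₁⟩
  intro y hy
  have hy' : y ∈ exitLocus g hY I n := by rw [← hCsupp]; exact hy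
  change ((n : ℕ) : ℕ∞) ≤ idealOrder I y
  rw [hy'.1]

/-- **KERNEL.** `OneShotPort n` for every `n ≥ 2` — the exact binder shape the landed wirings
`FaceFormCutClasses.genericRung_of_engine` / `genRungAt_of_engine` consume. [folklore] -/
theorem oneShotPort_holds' : ∀ n : ℕ, 2 ≤ n → OneShotPort n := fun n _ => oneShotPort_holds n

/-- **KERNEL (0-weight hygiene).** `OrderOneContact` holds hypothesis-free. [folklore] -/
theorem orderOneContact_holds : OrderOneContact := by
  intro p hp k _ _ Y g hg1 hg2 hg3 hY I y hy
  haveI := hg2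
  exact isContactPt_one g I hy

end Kernel

section Residual

open Summit.ResolutionOfSingularities.ResolutionOfSingularities.Theorems.DeltaFaceCutClasses
open Summit.ResolutionOfSingularities.ResolutionOfSingularities.Theorems.RelativeDeltaCut
open Summit.ResolutionOfSingularities.ResolutionOfSingularities.Theorems.CrossCut

/-! ## §K.7  The PORT RESIDUAL, typed (0-weight): multi-unit package transport -/

/-- **Weak admissibility of a concatenation** (`CentreSeq.append`): `s ⧺ t` is weakly admissible for `M` iff `s`
is for `M` and `t` is for the transform of `M` along `s` (the `WeakAdmissible` analogue of the tree's
`CentreSeq.isAdmissibleFor_append_iff`). [folklore] -/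
theorem weakAdmissible_append_iff : ∀ {Y : Scheme.{0}} (s : CentreSeq Y) (t : CentreSeq s.top)
    (M : MarkedIdeal Y),
    WeakAdmissible (s.append t) M ↔ WeakAdmissible s M ∧ WeakAdmissible t (s.transformMarked M)
  | _, .nil _, t, M => by simp [WeakAdmissible]
  | _, .cons C rest, t, M => by
    change WeakAdmissible (CentreSeq.cons C (rest.append t)) M ↔ _
    simp only [WeakAdmissible, CentreSeq.transformMarked_cons]
    rw [weakAdmissible_append_iff rest t]
    tauto

/-- **Concatenation, multi-step form** (any weakly admissible first part `s`): a weak resolution of the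
transform of `M` along `s` appended to `s` is a weak resolution of `M`
(`CentreSeq.support_transformMarked_append_eq_empty_iff`). [folklore] -/
theorem weakResolution_append {Y : Scheme.{0}} (s : CentreSeq Y) (t : CentreSeq s.top) (M : MarkedIdeal Y)
    (hs : WeakAdmissible s M) (ht : WeakResolution t (s.transformMarked M)) :
    WeakResolution (s.append t) M :=
  ⟨(weakAdmissible_append_iff s t M).mpr ⟨hs, ht.1⟩,
    (CentreSeq.support_transformMarked_append_eq_empty_iff s t M).mpr ht.2⟩

/-- **`MultiUnitPackageTransport n` — THE PORT RESIDUAL, TYPED** (the letter of the remaining MAP target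
«`ComponentPackagePort` WHOLE»): in the frame of `ComponentPackagePort n` (dim-4 `k`-variety, top points of class
`≥ 2` or one of the four unit-exit kinds — near-exit points, package-exit points, Top-isolated curves with packages,
top components with packages), there is a WEAKLY ADMISSIBLE sequence of blow-ups for `(𝓘, ∅, n)` with regular top
after which the controlled transform still has order `≤ n` and EVERY top point is of class `≥ 2` for the composite
`k`-structure `t.comp ≫ g`.  It is `ComponentPackagePort n` minus its final `SeqDimFour 2 n` step
(`componentPackagePort_of_multiUnitPackageTransport`); its content is the transport of the units' packages
(`PackageExitsOver`, global sequences with centres over one unit) through one another's blow-ups off their centres —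
the one-centre layer of this node is the case «all units are isolated exit points, one centre through all of them».
STATEMENT (residual; UNDECIDED; NOT claimed). -/
def MultiUnitPackageTransport (n : ℕ) : Prop :=
  ∀ p : ℕ, p.Prime → ∀ (k : Type) [Field k] [CharP k p]
    (Y : Scheme.{0}) (g : Y ⟶ Spec (.of k)), IsSeparated g → LocallyOfFiniteType g → QuasiCompact g →
    ∀ hY : Scheme.IsRegular Y, topologicalKrullDim Y ≤ 4 →
    ∀ I : Y.IdealSheafData, (∀ y : Y, idealOrder I y ≤ ((n : ℕ) : ℕ∞)) →
      (∀ y : Y, idealOrder I y = ((n : ℕ) : ℕ∞) →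
        ClassGE g hY I n 2 y ∨ VeryNearCutClasses.IsNearExitPt I n y ∨ IsPackageExitPt I n y ∨
          IsCurveExitPt I n y ∨ IsComponentExitPt I n y) →
      ∃ t : CentreSeq Y, WeakAdmissible t (⟨I, [], n⟩ : MarkedIdeal Y) ∧
        ∃ hT : Scheme.IsRegular t.top,
          (∀ x : t.top,
            idealOrder (t.transformMarked (⟨I, [], n⟩ : MarkedIdeal Y)).ideal x ≤ ((n : ℕ) : ℕ∞)) ∧
          ∀ x : t.top, idealOrder (t.transformMarked (⟨I, [], n⟩ : MarkedIdeal Y)).ideal x = ((n : ℕ) : ℕ∞) →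
            ClassGE (t.comp ≫ g) hT (t.transformMarked (⟨I, [], n⟩ : MarkedIdeal Y)).ideal n 2 x

/-- **KERNEL (0-weight; fixes the letter of the remaining MAP target).**
`MultiUnitPackageTransport n → ComponentPackagePort n`: the frame of `SeqDimFour` survives along ANY sequence of
blow-ups (`CentreSeq.isProper_comp`, `CentreSeq.topologicalKrullDim_top_le`), `SeqDimFour 2 n` resolves the
transported datum, `weakResolution_append` concatenates. [folklore] -/
theorem componentPackagePort_of_multiUnitPackageTransport {n : ℕ} (hT : MultiUnitPackageTransport n) :
    ComponentPackagePort n := by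
  intro h2 p hp k _ _ Y g hg1 hg2 hg3 hY h4 I hord hcls
  haveI := hg1; haveI := hg2; haveI := hg3
  haveI : IsLocallyNoetherian Y := LocallyOfFiniteType.isLocallyNoetherian g
  obtain ⟨t, hadm, hTop, hordT, hclsT⟩ := hT p hp k Y g hg1 hg2 hg3 hY h4 I hord hcls
  haveI : IsProper t.comp := t.isProper_comp
  have hdim : topologicalKrullDim t.top ≤ 4 := by
    have := CentreSeq.topologicalKrullDim_top_le t (N := 4) (by exact_mod_cast h4)
    exact_mod_cast this
  obtain ⟨t₁, ht₁⟩ := h2 p hp k t.top (t.comp ≫ g) inferInstance inferInstance inferInstance hTop hdim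
    (t.transformMarked (⟨I, [], n⟩ : MarkedIdeal Y)).ideal hordT hclsT
  refine ⟨t.append t₁, weakResolution_append t t₁ _ hadm ?_⟩
  exact (ForcedTowerClasses.weakResolution_congr t₁ (t.transformMarked (⟨I, [], n⟩ : MarkedIdeal Y))
    ⟨(t.transformMarked (⟨I, [], n⟩ : MarkedIdeal Y)).ideal, [], n⟩ rfl
    (CentreSeq.transformMarked_mult t _)).mpr ht₁

/-- **The one-centre layer IS the point-unit case of the residual**: for data whose non-class-≥-2 top points are
isolated exit points (the frame of `OneShotPort`), the one-shot centre realises `MultiUnitPackageTransport`'s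
conclusion with the ONE-STEP sequence `[exitCentre]`. [folklore] -/
theorem multiUnit_conclusion_of_exitPts (n : ℕ) :
    ∀ p : ℕ, p.Prime → ∀ (k : Type) [Field k] [CharP k p]
    (Y : Scheme.{0}) (g : Y ⟶ Spec (.of k)), IsSeparated g → LocallyOfFiniteType g → QuasiCompact g →
    ∀ hY : Scheme.IsRegular Y, topologicalKrullDim Y ≤ 4 →
    ∀ I : Y.IdealSheafData, (∀ y : Y, idealOrder I y ≤ ((n : ℕ) : ℕ∞)) →
      (∀ y : Y, idealOrder I y = ((n : ℕ) : ℕ∞) → ClassGE g hY I n 2 y ∨ IsExitPt I n y) →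
      ∃ t : CentreSeq Y, WeakAdmissible t (⟨I, [], n⟩ : MarkedIdeal Y) ∧
        ∃ hT : Scheme.IsRegular t.top,
          (∀ x : t.top,
            idealOrder (t.transformMarked (⟨I, [], n⟩ : MarkedIdeal Y)).ideal x ≤ ((n : ℕ) : ℕ∞)) ∧
          ∀ x : t.top, idealOrder (t.transformMarked (⟨I, [], n⟩ : MarkedIdeal Y)).ideal x = ((n : ℕ) : ℕ∞) →
            ClassGE (t.comp ≫ g) hT (t.transformMarked (⟨I, [], n⟩ : MarkedIdeal Y)).ideal n 2 x := by
  intro p hp k _ _ Y g hg1 hg2 hg3 hY h4 I hord hcls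
  haveI := hg1; haveI := hg2; haveI := hg3
  haveI : IsLocallyNoetherian Y := LocallyOfFiniteType.isLocallyNoetherian g
  haveI : CompactSpace Y := QuasiCompact.compactSpace_of_compactSpace g
  haveI : IsNoetherian Y := {}
  set C : Y.IdealSheafData := exitCentre hcls with hC
  have hCsupp : (C.support : Set Y) = exitLocus g hY I n := coe_support_exitCentre hcls
  have hCreg : Scheme.IsRegular C.subscheme := isRegular_exitCentre_subscheme hcls
  have hπ : IsBlowup (blowup.π C) C := blowup.isBlowup C
  haveI : IsProper (blowup.π C) := hπ.isProper
  haveI : IsLocallyNoetherian (blowup C) := LocallyOfFiniteType.isLocallyNoetherian (blowup.π C)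
  have hY₁ : Scheme.IsRegular (blowup C) := IsBlowup.isRegular_of_isRegular_subscheme hY hCreg hπ
  refine ⟨CentreSeq.cons C (CentreSeq.nil _), ?_, hY₁, ?_, ?_⟩
  · simp only [WeakAdmissible]
    refine ⟨?_, hCreg, trivial⟩
    intro y hy
    have hy' : y ∈ exitLocus g hY I n := by rw [← hCsupp]; exact hy
    change ((n : ℕ) : ℕ∞) ≤ idealOrder I y
    rw [hy'.1]
  · intro x
    exact hπ.idealOrder_controlledTransform_le_of_forall hY hCreg
      (fun y hy => by exact (show y ∈ exitLocus g hY I n from hy).1) hord x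
  · intro x hx
    change ClassGE (blowup.π C ≫ g) hY₁ (controlledTransform (blowup.π C) C I n) n 2 x
    by_cases hxS : (blowup.π C) x ∈ exitLocus g hY I n
    · exact classGE_controlledTransform_exitCentre hcls hπ hY₁ hxS hx
    · have hxC : (blowup.π C) x ∉ (C.support : Set Y) := by rw [hCsupp]; exact hxS
      have hordx : idealOrder I ((blowup.π C) x) = n := by
        rw [← hπ.idealOrder_controlledTransform_of_not_mem I n hxC]; exact hx
      have hcl0 : ClassGE g hY I n 2 ((blowup.π C) x) := by
        by_contra hno; exact hxS ⟨hordx, hno⟩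
      exact classGE_controlledTransform_of_not_mem g hπ hY hY₁ I n n 2 hxC hcl0

end Residual

end Summit.ResolutionOfSingularities.ResolutionOfSingularities.Theorems.ExitCut
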